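import Summits.Ventures.HodgeRepro2.T5DualPairSwap

/-!
# T5CharacterPartner — the zero-dimensional tower step: partners of a one-dimensional Weil
representation («one excluded value per place»)

Kernel witness (cell pub-hodge-repro2, seat p3, Tier-5 support for sub-step N4.2 / N2) for the
one-line [A]s of route/T5-route-3.md (N4.2, rows B3–B4 and the §E correction):

* l. 26: «Θ_χ(β′_v, 0-space) ≠ 0 ⟺ β′_v = 1 (ω for (U(V′), U(0)) is the trivial representation)
  [A, one line]»;
* l. 40 / l. 82: «the Weil representation of G(W) [for the 0-dimensional space] is the
  one-dimensional representation … a CHARACTER c_v(χ) of G(W) … So the correct criterion is: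
  Θ_χ(β′_v, V₀) ≠ 0 ⟺ β′_v = c_v(χ_v)^{±1} … one excluded value per place»;
* l. 27: «Hom(ω, β′_v ⊗ π₀,v) ≠ 0 is symmetric in the two members [A, one line]» — this one is
  `T5DualPairSwap.hasPartner_swap_iff` (p393520), cited, not re-proved.

What is kernel-checked here (Mathlib + the cell's own `twist` / `extTprod` / `HasPartner`,
nothing re-declared): for characters `χ : G × H →* kˣ`, `β : G →* kˣ`, `π : H →* kˣ` and their
one-dimensional representations `ofCharacter` on the line `k`,

* `hasPartner_ofCharacter_iff`: `Hom_{G×H}(ofCharacter χ, ofCharacter β ⊠ ofCharacter π) ≠ 0`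
  iff `χ (g, h) = β g · π h` for all `g, h`;
* `hasPartner_ofCharacter_iff'`: … iff `β = χ ∘ inl` and `π = χ ∘ inr` — for a fixed
  one-dimensional `ω = ofCharacter χ` and a fixed `π` there is at most ONE partner `β`
  (`partner_unique`), namely the restriction of `χ` to the first factor: «one excluded value»;
* `hasPartner_trivial_iff`: for the trivial `ω`, a partner exists iff `β = 1` and `π = 1`.

What stays prose (labels unchanged): that the Weil representation of the pair `(U(V′), U(0))`
IS the character `c_v(χ)` of the printed normalisation (HKS (1.15) at `m = 0`), and the
identification of the tower's first occurrence with this criterion.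

README §8(d): this file uses an L-value-free non-vanishing device: NO.
-/

namespace Summit.Ventures.HodgeRepro2.T5CharacterPartner

open Summit.Ventures.HodgeRepro2.T5SplittingTwist (extTprod extTprod_apply twist twist_apply
  twist_apply_apply twist_one)
open Summit.Ventures.HodgeRepro2.T5DualPairSwap (HasPartner)
open TensorProduct Representation

variable {k G H : Type*} [Field k] [Monoid G] [Monoid H]

section OfCharacter

variable {M : Type*} [Monoid M]

/-- The one-dimensional representation of a character `χ : M →* kˣ` on the line `k`: the trivial
representation twisted by `χ`. -/
noncomputable def ofCharacter (χ : M →* kˣ) : Representation k M k :=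
  twist (Representation.trivial k M k) χ

/-- `ofCharacter χ m a = χ m · a`. -/
theorem ofCharacter_apply (χ : M →* kˣ) (m : M) (a : k) :
    ofCharacter χ m a = (χ m : k) * a := by
  simp [ofCharacter]

/-- `ofCharacter χ m` is the scalar `χ m` times the identity. -/
theorem ofCharacter_eq_smul_id (χ : M →* kˣ) (m : M) :
    ofCharacter χ m = (χ m : k) • LinearMap.id := by
  ext
  simp [ofCharacter_apply]

/-- The trivial character gives the trivial representation. -/
theorem ofCharacter_one : ofCharacter (1 : M →* kˣ) = Representation.trivial k M k :=
  twist_one _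

end OfCharacter

section Partner

/-- The external tensor product of two one-dimensional representations acts by the product of
the two scalars. -/
theorem extTprod_ofCharacter_apply (β : G →* kˣ) (π : H →* kˣ) (g : G) (h : H) (x : k ⊗[k] k) :
    extTprod (ofCharacter β) (ofCharacter π) (g, h) x = ((β g : k) * (π h : k)) • x := by
  rw [extTprod_apply, ofCharacter_eq_smul_id, ofCharacter_eq_smul_id, TensorProduct.map_smul_left,
    TensorProduct.map_smul_right, TensorProduct.map_id, mul_smul]
  rfl

/-- A linear map out of the line is determined by its value at `1`. -/
theorem linearMap_apply_eq_smul {W : Type*} [AddCommGroup W] [Module k W] (f : k →ₗ[k] W)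
    (a : k) : f a = a • f 1 := by
  rw [← f.map_smul, smul_eq_mul, mul_one]

/-- `1 ⊗ 1 ≠ 0` in `k ⊗[k] k`. -/
theorem one_tmul_one_ne_zero : ((1 : k) ⊗ₜ[k] (1 : k)) ≠ 0 := by
  intro h
  have := congrArg (TensorProduct.lid k k) h
  simp at this

/-- `Hom_{G×H}(χ, β ⊠ π) ≠ 0` for one-dimensional representations iff `χ (g, h) = β g · π h`
for all `g, h`. -/
theorem hasPartner_ofCharacter_iff (χ : G × H →* kˣ) (β : G →* kˣ) (π : H →* kˣ) :
    HasPartner (ofCharacter χ) (ofCharacter β) (ofCharacter π) ↔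
      ∀ (g : G) (h : H), χ (g, h) = β g * π h := by
  constructor
  · rintro ⟨f, hf0, hf⟩ g h
    have hx : f 1 ≠ 0 := by
      intro h0
      apply hf0
      ext
      rw [h0, LinearMap.zero_apply]
    have hy : TensorProduct.lid k k (f 1) ≠ 0 := fun h0 => hx ((TensorProduct.lid k k).map_eq_zero_iff.mp h0)
    have key := hf.isIntertwining (g, h) 1
    rw [ofCharacter_apply, mul_one, linearMap_apply_eq_smul f, extTprod_ofCharacter_apply] at key
    have key' := congrArg (TensorProduct.lid k k) key
    rw [map_smul, map_smul, smul_eq_mul, smul_eq_mul] at key'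
    apply Units.ext
    rw [Units.val_mul]
    exact mul_right_cancel₀ hy key'
  · intro hχ
    refine ⟨LinearMap.id.smulRight ((1 : k) ⊗ₜ[k] (1 : k)), ?_, ?_⟩
    · intro h0
      have := LinearMap.congr_fun h0 1
      simp only [LinearMap.smulRight_apply, LinearMap.id_apply, one_smul, LinearMap.zero_apply] at this
      exact one_tmul_one_ne_zero this
    · refine ⟨fun p a => ?_⟩
      obtain ⟨g, h⟩ := p
      simp only [LinearMap.smulRight_apply, LinearMap.id_apply, ofCharacter_apply,
        extTprod_ofCharacter_apply, smul_smul]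
      rw [hχ g h, Units.val_mul, mul_comm]

/-- The same criterion in closed form: a partner exists iff `β` and `π` are the restrictions of
`χ` to the two factors. -/
theorem hasPartner_ofCharacter_iff' (χ : G × H →* kˣ) (β : G →* kˣ) (π : H →* kˣ) :
    HasPartner (ofCharacter χ) (ofCharacter β) (ofCharacter π) ↔
      β = χ.comp (MonoidHom.inl G H) ∧ π = χ.comp (MonoidHom.inr G H) := by
  rw [hasPartner_ofCharacter_iff]
  constructor
  · intro hχ
    refine ⟨MonoidHom.ext fun g => ?_, MonoidHom.ext fun h => ?_⟩
    · have := hχ g 1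
      rw [map_one, mul_one] at this
      exact this.symm
    · have := hχ 1 h
      rw [map_one, one_mul] at this
      exact this.symm
  · rintro ⟨rfl, rfl⟩ g h
    have : ((g, h) : G × H) = (g, 1) * (1, h) := by simp
    rw [this, map_mul]
    rfl

/-- «One excluded value per place»: for a fixed one-dimensional `ω = ofCharacter χ` and a fixed
`π`, the partner `β` is unique. -/
theorem partner_unique (χ : G × H →* kˣ) {β₁ β₂ : G →* kˣ} {π : H →* kˣ}
    (h₁ : HasPartner (ofCharacter χ) (ofCharacter β₁) (ofCharacter π))
    (h₂ : HasPartner (ofCharacter χ) (ofCharacter β₂) (ofCharacter π)) : β₁ = β₂ := by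
  rw [hasPartner_ofCharacter_iff'] at h₁ h₂
  rw [h₁.1, h₂.1]

/-- The zero-dimensional tower step of l. 26: for the TRIVIAL `ω`, a partner exists iff `β = 1`
and `π = 1`. -/
theorem hasPartner_trivial_iff (β : G →* kˣ) (π : H →* kˣ) :
    HasPartner (Representation.trivial k (G × H) k) (ofCharacter β) (ofCharacter π) ↔
      β = 1 ∧ π = 1 := by
  rw [← ofCharacter_one, hasPartner_ofCharacter_iff']
  simp only [MonoidHom.one_comp]

end Partner

end Summit.Ventures.HodgeRepro2.T5CharacterPartner
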